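import Summits.QuantumFields.BalabanUV.T4Continuum.Support.NE4TwoRunStepModelEnd

/-!
# NE4TwoRunStepModelWitness — NON-VACUITY of the binder list of `NE4TwoRunStepModelEnd.injectedRate_of_stepModel₂`
# (binder row NE4, spine node U2, technique P2 «two-trajectory comparison»; cell `pub-balaban`, co-owner seat t4-ne4-p2,
# gen 19; skeleton `HOME/t4/skeletons/NE4-t4-ne4-p2.md` §5c)

HONEST FRAMING.  Rung (B)+1 on a FIXED finite torus T⁴ — NOT infinite volume, NOT a mass gap, NOT Clay.  NE4 is NOT PRINTED
and NOT PROVED.  This module is a CONSISTENCY CERTIFICATE for unprinted HYPOTHESIS SHAPES: it exhibits ONE instance in which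
EVERY binder of `injectedRate_of_stepModel₂` holds SIMULTANEOUSLY — row NE5's toy step model `T4InputCauchyRateData.toyModel`
(`Out(o, h) = o + h`, operator data `(1/2)^k` vs `0`, a genuine damped history feed with gain `1/64`) restricted to the
window `T4OutputRate.Window γ`, the PURE ONE-LOOP history-free family `betaConst b₀` (β¹ ≡ 0, so (AF-0r) holds with `c₀ = 0`
and the β read-out binder with any `r ≥ 0`), and the EXPLICIT infrared-pinned runs of (0.20) for that family,
`gRun b₀ gIR K k = √(1 / (gIR⁻² + b₀·(K − k)))` (box ]0, γ], pin `g K K = gIR`, every coordinate in the window).  The toy is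
not Bałaban's scheme; it says nothing about WHICH constants Bałaban's (2.13) realises.  What it certifies: the 35 binders
(eight NE5 shapes, two coupling-data shapes, read-out, (AF-0r), runs/box/pin, window membership and diameter, and the
scalars — near hypothesis, first scales, `θ ≤ ρ < 1`, memory gap `ω(1 + Λc) < ρ`, γ-window) are JOINTLY SATISFIABLE, so
the END is not vacuous.  HONEST DEPENDENCY (cell, verbatim): continuum YM on T⁴ ⇐ BetaPertH ∧ nine spine estimates (0/9
proved); BetaPertH ⇐ (D1) ∧ (D4) ∧ CAP+tail; G-an2-4 gates asym, D1 and NE2/3/4.  NOT summit progress.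

CONTENT.  §1 the pure one-loop family and its one-loop split; the explicit runs and their properties (RGEqH, box, pin,
window).  §2 the toy step model's shapes restricted to the window (row NE5's `toy_*` BY NAME), the two coupling-data shapes
with `ℓop = ℓins = 0` (the toy data maps do not read the coupling), the read-out binder with `r = 1`.  §3 the END applied:
`T4CauchySum.InjectedRate D 0 (1/2) (fun K j ↦ disc (gRun K) (gRun (K+1)) j)` for the explicit runs — every binder
inhabited at once (`Λ = 1`, `δ = 1`, `δ′ = 0`, `θ = ρ = 1/2`, `c = 1`, `ω = 1/64`, `ρ₀ = 1`, `k₀ = 1`, `B = 6`, `Γ = γ`).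
Module of unit `b2b-balaban-t4-ne4-p2` (gen 19); imports `NE4TwoRunStepModelEnd` only; no `sorry`, no `axiom`.
-/

namespace Summit.QuantumFields.BalabanUV.T4Continuum.NE4TwoRunStepModelWitness

open Literature.MathematicalPhysics.QuantumFieldTheory.Balaban1983to89
open T4OutputRate (Carriers Functional DecayBound Window)
open T4InputCauchyRate (toyCarriers toyEB)
open T4InputCauchyRateData (StepModel toyModel toyEA₂ toy_representsA toy_representsB toy_inBase toy_dataLipschitz
  toy_decayA toy_decayB toy_operatorRate toy_insertionRate toy_insertionDamped)
open FlowStep (HBeta RGEqH prefixOf)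
open T4TwoRunMatching (remMismatch)
open NE4TwoRunStepModel
open NE4TwoRunStepModelEnd
open Metric Set Finset

/-! ## §1 The pure one-loop family and its explicit infrared-pinned runs -/

/-- The PURE ONE-LOOP, history-free β-family: `β_{k+1}(g_0, …, g_k) = b₀` for every scale and history (a caricature;
β¹ ≡ 0). [folklore] -/
def betaConst (b₀ : ℝ) : HBeta := fun _ _ => b₀

/-- Its one-loop split: `β⁰ ≡ b₀`, `β¹ ≡ 0` (the printed vanishing at `g_k = 0` holds trivially). [folklore] -/
def splitConst (b₀ : ℝ) : B12Beta.OneLoopSplit (betaConst b₀) where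
  β0 := fun _ => b₀
  β1 := fun _ _ => 0
  split := fun _ _ => by simp [betaConst]
  vanish := fun _ _ _ => rfl

/-- The inverse-square coupling of the explicit run: `a K k = gIR⁻² + b₀·(K − k)` (natural subtraction: constant `gIR⁻²`
beyond the pin). [folklore] -/
noncomputable def invSq (b₀ gIR : ℝ) (K k : ℕ) : ℝ := 1 / gIR ^ 2 + b₀ * ((K - k : ℕ) : ℝ)

/-- THE EXPLICIT RUN of (0.20) for `betaConst b₀`, `K` steps, pinned at `gIR`: `g K k = √(1 / a K k)`. [folklore] -/
noncomputable def gRun (b₀ gIR : ℝ) (K k : ℕ) : ℝ := Real.sqrt (1 / invSq b₀ gIR K k)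

/-- `a K k ≥ gIR⁻² > 0`. [folklore] -/
theorem invSq_ge {b₀ gIR : ℝ} (hb₀ : 0 ≤ b₀) (K k : ℕ) : 1 / gIR ^ 2 ≤ invSq b₀ gIR K k :=
  le_add_of_nonneg_right (mul_nonneg hb₀ (Nat.cast_nonneg _))

/-- `a K k > 0`. [folklore] -/
theorem invSq_pos {b₀ gIR : ℝ} (hb₀ : 0 ≤ b₀) (hgIR : 0 < gIR) (K k : ℕ) : 0 < invSq b₀ gIR K k :=
  lt_of_lt_of_le (by positivity) (invSq_ge hb₀ K k)

/-- `1 / (g K k)² = a K k`. [folklore] -/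
theorem one_div_gRun_sq {b₀ gIR : ℝ} (hb₀ : 0 ≤ b₀) (hgIR : 0 < gIR) (K k : ℕ) :
    1 / gRun b₀ gIR K k ^ 2 = invSq b₀ gIR K k := by
  have ha := invSq_pos hb₀ hgIR K k
  rw [gRun, Real.sq_sqrt (by positivity), one_div_one_div]

/-- The run is positive. [folklore] -/
theorem gRun_pos {b₀ gIR : ℝ} (hb₀ : 0 ≤ b₀) (hgIR : 0 < gIR) (K k : ℕ) : 0 < gRun b₀ gIR K k :=
  Real.sqrt_pos.mpr (by have := invSq_pos hb₀ hgIR K k; positivity)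

/-- The run is bounded by its infrared value: `g K k ≤ gIR` (asymptotic freedom of the caricature). [folklore] -/
theorem gRun_le {b₀ gIR : ℝ} (hb₀ : 0 ≤ b₀) (hgIR : 0 < gIR) (K k : ℕ) : gRun b₀ gIR K k ≤ gIR := by
  have h0 : 0 < 1 / gIR ^ 2 := by positivity
  have h1 : 1 / invSq b₀ gIR K k ≤ gIR ^ 2 := by
    calc 1 / invSq b₀ gIR K k ≤ 1 / (1 / gIR ^ 2) := one_div_le_one_div_of_le h0 (invSq_ge hb₀ K k)
      _ = gIR ^ 2 := one_div_one_div _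
  calc gRun b₀ gIR K k ≤ Real.sqrt (gIR ^ 2) := Real.sqrt_le_sqrt h1
    _ = gIR := Real.sqrt_sq hgIR.le

/-- The infrared pin: `g K K = gIR`. [folklore] -/
theorem gRun_pin {b₀ gIR : ℝ} (hgIR : 0 < gIR) (K : ℕ) : gRun b₀ gIR K K = gIR := by
  simp [gRun, invSq, Real.sqrt_sq hgIR.le]

/-- The explicit run SOLVES (0.20) for the pure one-loop family: `1/g_k² = 1/g_{k+1}² + b₀` for `k < K`. [folklore] -/
theorem gRun_rgeq {b₀ gIR : ℝ} (hb₀ : 0 ≤ b₀) (hgIR : 0 < gIR) (K : ℕ) : RGEqH K (betaConst b₀) (gRun b₀ gIR K) := by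
  intro k hk
  rw [one_div_gRun_sq hb₀ hgIR, one_div_gRun_sq hb₀ hgIR]
  simp only [invSq, betaConst]
  rw [show K - k = (K - (k + 1)) + 1 by omega]
  push_cast
  ring

/-- Every coordinate of the explicit run lies in the window `]0, γ]` when `gIR ≤ γ`. [folklore] -/
theorem gRun_mem_window {b₀ gIR γ : ℝ} (hb₀ : 0 ≤ b₀) (hgIR : 0 < gIR) (hgIRγ : gIR ≤ γ) (K : ℕ) :
    gRun b₀ gIR K ∈ Window γ :=
  T4OutputRate.mem_window.mpr fun k => ⟨gRun_pos hb₀ hgIR K k, (gRun_le hb₀ hgIR K k).trans hgIRγ⟩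

/-- So does the shifted run `fun i ↦ g (K+1) (i+1)` (run B re-indexed to the common creation scale). [folklore] -/
theorem gRun_shift_mem_window {b₀ gIR γ : ℝ} (hb₀ : 0 ≤ b₀) (hgIR : 0 < gIR) (hgIRγ : gIR ≤ γ) (K : ℕ) :
    (fun i => gRun b₀ gIR (K + 1) (i + 1)) ∈ Window γ :=
  T4OutputRate.mem_window.mpr fun i => ⟨gRun_pos hb₀ hgIR (K + 1) (i + 1), (gRun_le hb₀ hgIR (K + 1) (i + 1)).trans hgIRγ⟩

/-- The window `]0, γ]^ℕ` has coordinatewise diameter `γ`. [folklore] -/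
theorem window_diam {γ : ℝ} : ∀ g₁ ∈ Window γ, ∀ g₂ ∈ Window γ, ∀ i, |g₁ i - g₂ i| ≤ γ := by
  intro g₁ h₁ g₂ h₂ i
  have a := (T4OutputRate.mem_window.mp h₁) i
  have b := (T4OutputRate.mem_window.mp h₂) i
  rw [abs_sub_le_iff]
  constructor <;> linarith

/-! ## §2 Row NE5's toy step model restricted to the window; the route's own binders on the toy -/

/-- The toy's representation of run A, on the window. [folklore] -/
theorem toy_representsA_window (γ : ℝ) : toyModel.RepresentsA toyEA₂ (Window γ) :=
  fun g _ U X => toy_representsA g (mem_univ g) U X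

/-- The toy's representation of run B, on the window. [folklore] -/
theorem toy_representsB_window (γ : ℝ) : toyModel.RepresentsB toyEB (Window γ) :=
  fun g _ U X => toy_representsB g (mem_univ g) U X

/-- The toy's admissibility of run B's data, on the window. [folklore] -/
theorem toy_inBase_window (γ : ℝ) : toyModel.InBase toyEB (Window γ) :=
  fun k g _ U => toy_inBase k g (mem_univ g) U

/-- The toy's data-Lipschitz wall (exact modulus `Λ = 1`, any reach), on the window. [folklore] -/
theorem toy_dataLipschitz_window (γ ρ₀ : ℝ) : toyModel.DataLipschitz (Window γ) 0 1 ρ₀ :=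
  fun k g _ U p hp X hX q hq1 hq2 => toy_dataLipschitz ρ₀ k g (mem_univ g) U p hp X hX q hq1 hq2

/-- The toy's one-run bound of run A, on the window. [folklore] -/
theorem toy_decayA_window (γ : ℝ) : DecayBound toyEA₂ (Window γ) 3 0 :=
  fun g _ U X => toy_decayA g (mem_univ g) U X

/-- The toy's one-run bound of run B, on the window. [folklore] -/
theorem toy_decayB_window (γ : ℝ) : DecayBound toyEB (Window γ) 3 0 :=
  fun g _ U X => toy_decayB g (mem_univ g) U X

/-- The toy's operator rate, on the window. [folklore] -/
theorem toy_operatorRate_window (γ : ℝ) : toyModel.OperatorRate (Window γ) 1 (1 / 2) :=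
  fun k g _ U => toy_operatorRate k g (mem_univ g) U

/-- The toy's insertion rate, on the window. [folklore] -/
theorem toy_insertionRate_window (γ : ℝ) : toyModel.InsertionRate (Window γ) 0 3 0 (1 / 2) :=
  fun k g _ U t ht => toy_insertionRate k g (mem_univ g) U t ht

/-- The toy's damped insertion (gain `1`, age factor `1/64`), on the window. [folklore] -/
theorem toy_insertionDamped_window (γ : ℝ) : toyModel.InsertionDamped (Window γ) 0 1 (1 / 64) :=
  fun k g _ U t t' D hD ht => toy_insertionDamped k g (mem_univ g) U t t' D hD ht

/-- The toy's operator data do not read the coupling: `CouplingDataOp` with `ℓop = 0`. [folklore] -/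
theorem toy_couplingDataOp (γ : ℝ) : CouplingDataOp toyModel (Window γ) 0 := by
  intro k g _ g' _ U
  simp [toyModel]

/-- The toy's insertion does not read the coupling: `CouplingDataIns` with `ℓins = 0`. [folklore] -/
theorem toy_couplingDataIns (γ : ℝ) : CouplingDataIns toyModel (Window γ) 0 3 0 := by
  intro k g _ g' _ U t _
  simp [toyModel]

/-- The β read-out binder for the pure one-loop family: β¹ ≡ 0, so the β¹-mismatch vanishes and is `r`-dominated by any
nonnegative majorant, for every `r ≥ 0` (here `r = 1`). [folklore] -/
theorem toy_readOut (b₀ κ : ℝ) (gA gB : ℕ → ℝ) (K : ℕ) :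
    TwoRunReadOutModel (splitConst b₀) 1 toyEA₂ toyEB κ gA gB K := by
  intro j _ D hD _
  have : remMismatch (splitConst b₀) gA gB j = 0 := by simp [remMismatch, splitConst]
  rw [this, one_mul]
  exact hD

/-! ## §3 The END applied: every binder of `injectedRate_of_stepModel₂` inhabited at once -/

/-- **NON-VACUITY OF THE TWO-RUN END FROM ROW NE5's STEP MODEL.**  For every `b₀ ≥ 0` and every infrared value
`gIR ∈ ]0, γ]`, the explicit pinned runs `gRun b₀ gIR K` of the pure one-loop family, row NE5's toy step model on the
window `]0, γ]^ℕ`, the vanishing coupling-data moduli, the read-out binder with `r = 1`, and the scalars `Λ = 1`, `δ = 1`,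
`δ′ = 0`, `θ = ρ = 1/2`, `c = 1`, `ω = 1/64`, `ρ₀ = 1`, `k₀ = 1`, `B = 6`, `Γ = γ`, `c₀ = 0` satisfy ALL hypotheses of
`NE4TwoRunStepModelEnd.injectedRate_of_stepModel₂`, which therefore yields node U2's output shape
`T4CauchySum.InjectedRate D 0 (1/2)` for the coupling discrepancies of consecutive runs (here in fact `disc ≡ 0`: pure
one-loop runs pinned at one value match exactly at partnered scales — the certificate is about JOINT SATISFIABILITY of the
binders, not about the size of the constant).  A consistency certificate for unprinted hypothesis shapes; the toy is not
Bałaban's scheme. [folklore] -/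
theorem injectedRate_toy {b₀ γ gIR : ℝ} (hb₀ : 0 ≤ b₀) (hgIR : 0 < gIR) (hgIRγ : gIR ≤ γ) :
    T4CauchySum.InjectedRate
      (2 * (2 * 0 + 1 * ((1 * (1 + 0) + 6) + 1 * 1 * (1 / 64) * ((1 * (1 + 0) + 6) + 1 * (0 + 0) * γ))
        * ((1 / 2 - 1 / 64) / (1 / 2 - 1 / 64 * (1 + 1 * 1)))) / (1 - 1 / 2)) 0 (1 / 2)
      (fun K j => T4CouplingMatching.disc (gRun b₀ gIR K) (gRun b₀ gIR (K + 1)) j) := by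
  have hγ : 0 < γ := hgIR.trans_le hgIRγ
  refine injectedRate_of_stepModel₂ (splitConst b₀) (gRun b₀ gIR) gIR toyModel (EA := toyEA₂) (EB := toyEB)
    (W := Window γ) (κ := 0) (Λ := 1) (EA₀ := 3) (E₀ := 3) (δ := 1) (δ' := 0) (θ := 1 / 2) (c := 1) (ω := 1 / 64)
    (ρ₀ := 1) (B := 6) (ℓop := 0) (ℓins := 0) (Γ := γ) (γ := γ) (binf := b₀) (c₀ := 0) (r := 1) (ρ := 1 / 2) (k₀ := 1)
    (toy_representsA_window γ) (toy_representsB_window γ) (toy_inBase_window γ) (toy_dataLipschitz_window γ 1)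
    (toy_decayA_window γ) (toy_decayB_window γ) (toy_operatorRate_window γ) (toy_insertionRate_window γ)
    (toy_insertionDamped_window γ) (toy_couplingDataOp γ) (toy_couplingDataIns γ)
    (fun K => toy_readOut b₀ 0 (gRun b₀ gIR K) (gRun b₀ gIR (K + 1)) K)
    (fun K => gRun_rgeq hb₀ hgIR K)
    (fun K i _ => ⟨gRun_pos hb₀ hgIR K i, (gRun_le hb₀ hgIR K i).trans hgIRγ⟩)
    (fun K => gRun_pin hgIR K)
    (fun K => gRun_mem_window hb₀ hgIR hgIRγ K) (fun K => gRun_shift_mem_window hb₀ hgIR hgIRγ K) window_diam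
    (fun k => by simp [splitConst])
    zero_le_one (by norm_num) (by norm_num) le_rfl (by norm_num) zero_le_one (by norm_num) le_rfl le_rfl (by norm_num)
    le_rfl zero_le_one (by norm_num) ?_ (by norm_num) ?_
  · intro k hk
    have hk0 : k = 0 := by omega
    subst hk0
    norm_num
  · have h0 : (1 : ℝ) * (1 * (0 + 0) * γ ^ 3) * ((1 / 2 - 1 / 64) / (1 / 2 - 1 / 64 * (1 + 1 * 1))) = 0 := by ring
    rw [h0]
    norm_num

/-- The binder list of the two-run END is inhabited (existential summary of `injectedRate_toy` at `b₀ = 1/2`,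
`γ = gIR = 1/16`). [folklore] -/
theorem end_binders_inhabited :
    ∃ (D : ℝ) (g : ℕ → ℕ → ℝ), (∀ K, RGEqH K (betaConst (1 / 2)) (g K)) ∧ (∀ K, g K K = 1 / 16) ∧
      T4CauchySum.InjectedRate D 0 (1 / 2) (fun K j => T4CouplingMatching.disc (g K) (g (K + 1)) j) :=
  ⟨_, gRun (1 / 2) (1 / 16), fun K => gRun_rgeq (by norm_num) (by norm_num) K, fun K => gRun_pin (by norm_num) K,
    injectedRate_toy (γ := 1 / 16) (by norm_num) (by norm_num) le_rfl⟩

end Summit.QuantumFields.BalabanUV.T4Continuum.NE4TwoRunStepModelWitness
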